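import Mathlib.AlgebraicGeometry.AffineScheme
import HarnessLib

/-!
# Principal affine covers refine: subordinate to any open cover, and finite on quasi-compact schemes

Topic `Literature/AlgebraicGeometry/Morphisms`; THEOREMS only (no definition, no named fact, no instance), Mathlib only.
A **principal affine cover** of a scheme `X` is a family of affine opens `U j` covering `X` with
`U j ∩ U l = D(b_{jl})`, `b_{jl} ∈ Γ(X, U j)` (the `(U, b, hb)` currency of the tree's Čech / deformation files; producers:
★ `Morphisms/PrincipalAffineCoverOfProj`, ★ `Morphisms/NilpotentThickeningCoverLift`).  THE PRINT (Hartshorne II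
Ex. 2.16 (a)–style bookkeeping / EGA I (1.1.10), Stacks 01IQ–01IS): inside the affine `U j` the principal opens `D(g)`,
`g ∈ Γ(X, U j)`, form a basis, a principal open of a principal open of `U j` is a principal open of `U j`
(Mathlib `IsAffineOpen.basicOpen_basicOpen_is_basicOpen`), and `D(g) ∩ D(h) = D(gh)`; hence:

* **`exists_principal_affine_cover_refinement`** — given a principal affine cover `(U, b)` and ANY open cover `W` of
  `X`, the principal opens `V x := D(g_x) ∋ x` (`g_x ∈ Γ(X, U j(x))`, `D(g_x) ⊆ W a(x)`) form a principal affine cover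
  subordinate to `W` and to `U`: `D(g_x) ∩ D(g_y) = D(g_x · f)` where `D(f) = U_{j(x)} ∩ U_{j(y)} ∩ D(g_y)` is the
  principal open `D_{D(b)}(g_y|)` of `U_{j(x)}`;
* `exists_finite_principal_affine_cover_refinement` — on a quasi-compact scheme, finitely many of them suffice.

Cell `hodgecm-mathlib`, F-11 road A (crux `HDel`): with ★ `PrincipalAffineCoverOfProj` and ★
`NilpotentThickeningCoverLift` this gives MONO-G2's «principal affine cover of the lift subordinate to a trivialising
cover of `L₀`» (F0P1b-p07's letter). HC_CM is proved only modulo the 7 printed citations until rung 0 closes — nothing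
here bears on a summit statement.

## References
* [Hartshorne1977] R. Hartshorne, *Algebraic Geometry*, GTM 52 (1977), II Prop. 2.2 and Ex. 2.1, Ex. 2.16 (a)
  (principal opens of affine schemes), III Thm. 4.5 proof (covers by principal affines).
* [StacksProject] The Stacks Project, Tag 01IQ / 01IS (affine schemes: standard opens form a basis; `D(f) ∩ D(g) = D(fg)`),
  Tag 01K4 (quasi-compact schemes: finite affine subcovers).
* [GortzWedhorn2020] U. Görtz, T. Wedhorn, *Algebraic Geometry I*, 2nd ed. (2020), Prop. 2.5 / (2.11), Prop. 3.2.
-/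

noncomputable section

universe u

open CategoryTheory AlgebraicGeometry TopologicalSpace

namespace Literature.AlgebraicGeometry.Morphisms

variable {X : Scheme.{u}}

/-- **Principal affine covers refine, subordinate to any open cover** (pointwise form, indexed by the points of `X`):
for a principal affine cover `(U, b)` (`U j ∩ U l = D(b_{jl})`) and an open cover `W`, there are principal opens
`V x = D(g_x) ∋ x` of members of `U`, inside members of `W`, forming again a PRINCIPAL affine cover.
[cite: Hartshorne1977, II Prop. 2.2 and Ex. 2.16 (a)] [cite: StacksProject, Tag 01IS] -/
theorem exists_principal_affine_cover_refinement {ι : Type*} (U : ι → X.affineOpens)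
    (b : (j l : ι) → Γ(X, (U j).1)) (hb : ∀ j l, (U j).1 ⊓ (U l).1 = X.basicOpen (b j l))
    (hU : ⨆ j, (U j).1 = ⊤) {κ : Type*} (W : κ → X.Opens) (hW : ⨆ a, W a = ⊤) :
    ∃ (V : X → X.affineOpens) (c : (x y : X) → Γ(X, (V x).1)),
      (∀ x, x ∈ (V x).1) ∧ (⨆ x, (V x).1 = ⊤) ∧ (∀ x y, (V x).1 ⊓ (V y).1 = X.basicOpen (c x y)) ∧
      (∀ x, ∃ j, (V x).1 ≤ (U j).1) ∧ (∀ x, ∃ a, (V x).1 ≤ W a) := by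
  -- principal neighbourhoods `x ∈ D(g_x) ⊆ U_{j(x)} ∩ W_{a(x)}`
  have hpt : ∀ x : X, ∃ (j : ι) (a : κ) (g : Γ(X, (U j).1)),
      X.basicOpen g ≤ W a ∧ x ∈ X.basicOpen g := fun x => by
    obtain ⟨j, hj⟩ := Opens.mem_iSup.mp (hU.ge (Set.mem_univ x) : x ∈ ⨆ j, (U j).1)
    obtain ⟨a, ha⟩ := Opens.mem_iSup.mp (hW.ge (Set.mem_univ x) : x ∈ ⨆ a, W a)
    obtain ⟨g, hgW, hxg⟩ := (U j).2.exists_basicOpen_le ⟨x, ha⟩ hj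
    exact ⟨j, a, g, hgW, hxg⟩
  choose j a g hgW hxg using hpt
  -- on `U_{j(x)}`: `U_{j(x)} ∩ U_{j(y)} ∩ D(g_y)` is a principal open `D(f x y)`
  have hle : ∀ x y, X.basicOpen (b (j x) (j y)) ≤ (U (j y)).1 := fun x y => by
    rw [← hb]
    exact inf_le_right
  have hf : ∀ x y, ∃ f : Γ(X, (U (j x)).1),
      X.basicOpen f = X.basicOpen (X.presheaf.map (homOfLE (hle x y)).op (g y)) := fun x y =>
    (U (j x)).2.basicOpen_basicOpen_is_basicOpen (b (j x) (j y)) _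
  choose f hf using hf
  refine ⟨fun x => ⟨X.basicOpen (g x), (U (j x)).2.basicOpen _⟩,
    fun x y => X.presheaf.map (homOfLE (X.basicOpen_le (g x))).op (g x * f x y),
    hxg, ?_, fun x y => ?_, fun x => ⟨j x, X.basicOpen_le _⟩, fun x => ⟨a x, hgW x⟩⟩
  · exact top_le_iff.mp fun x _ => Opens.mem_iSup.mpr ⟨x, hxg x⟩
  · -- `D(g_x) ∩ D(g_y) = D(g_x · f)` with `D(f) = U_{j(x)} ∩ U_{j(y)} ∩ D(g_y)`
    change X.basicOpen (g x) ⊓ X.basicOpen (g y) = _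
    have e1 : X.basicOpen (g x) ⊓ (U (j x)).1 = X.basicOpen (g x) := inf_eq_left.mpr (X.basicOpen_le _)
    have e2 : (U (j y)).1 ⊓ X.basicOpen (g y) = X.basicOpen (g y) := inf_eq_right.mpr (X.basicOpen_le _)
    rw [Scheme.basicOpen_res, Scheme.basicOpen_mul, ← inf_assoc, inf_idem, hf, Scheme.basicOpen_res, ← hb]
    calc X.basicOpen (g x) ⊓ X.basicOpen (g y)
        = (X.basicOpen (g x) ⊓ (U (j x)).1) ⊓ ((U (j y)).1 ⊓ X.basicOpen (g y)) := by rw [e1, e2]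
      _ = X.basicOpen (g x) ⊓ ((U (j x)).1 ⊓ (U (j y)).1 ⊓ X.basicOpen (g y)) := by ac_rfl

/-- **On a quasi-compact scheme, a principal affine cover refines to a FINITE principal affine cover subordinate to any
open cover.** [cite: StacksProject, Tag 01K4] [cite: Hartshorne1977, II Ex. 2.16 (a)] -/
theorem exists_finite_principal_affine_cover_refinement [CompactSpace X] {ι : Type*} (U : ι → X.affineOpens)
    (b : (j l : ι) → Γ(X, (U j).1)) (hb : ∀ j l, (U j).1 ⊓ (U l).1 = X.basicOpen (b j l))
    (hU : ⨆ j, (U j).1 = ⊤) {κ : Type*} (W : κ → X.Opens) (hW : ⨆ a, W a = ⊤) :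
    ∃ (τ : Type u) (_ : Finite τ) (V : τ → X.affineOpens) (c : (s t : τ) → Γ(X, (V s).1)),
      (⨆ s, (V s).1 = ⊤) ∧ (∀ s t, (V s).1 ⊓ (V t).1 = X.basicOpen (c s t)) ∧
      (∀ s, ∃ j, (V s).1 ≤ (U j).1) ∧ (∀ s, ∃ a, (V s).1 ≤ W a) := by
  obtain ⟨V, c, hxV, -, hc, hVU, hVW⟩ := exists_principal_affine_cover_refinement U b hb hU W hW
  obtain ⟨t, ht⟩ := isCompact_univ.elim_finite_subcover (fun x : X => ((V x).1 : Set X))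
    (fun x => (V x).1.2) fun x _ => Set.mem_iUnion.mpr ⟨x, hxV x⟩
  refine ⟨↥t, inferInstance, fun s => V s.1, fun s s' => c s.1 s'.1, ?_, fun s s' => hc s.1 s'.1,
    fun s => hVU s.1, fun s => hVW s.1⟩
  refine top_le_iff.mp fun x _ => ?_
  obtain ⟨y, hy, hxy⟩ := Set.mem_iUnion₂.mp (ht (Set.mem_univ x))
  exact Opens.mem_iSup.mpr ⟨⟨y, hy⟩, hxy⟩

/-! ## ED. 2 (append-only): the refining opens as BASIC OPENS of members of `U` — the «(BO)» form -/

/-- **(BO) form of the refinement**: the same construction, exporting the refining opens as BASIC OPENS `D(g_x)` of members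
`U_{j(x)}` of the given cover (`g_x ∈ Γ(X, U_{j(x)})`) — the shape under which localisation arguments on `U_{j(x)}`
(restriction of automorphisms ∕ of lifted gluing data to `W`) apply verbatim.
[cite: Hartshorne1977, II Prop. 2.2 and Ex. 2.16 (a)] [cite: StacksProject, Tag 01IS] -/
theorem exists_principal_affine_cover_refinement_basicOpen {ι : Type*} (U : ι → X.affineOpens)
    (b : (j l : ι) → Γ(X, (U j).1)) (hb : ∀ j l, (U j).1 ⊓ (U l).1 = X.basicOpen (b j l))
    (hU : ⨆ j, (U j).1 = ⊤) {κ : Type*} (W : κ → X.Opens) (hW : ⨆ a, W a = ⊤) :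
    ∃ (j : X → ι) (g : (x : X) → Γ(X, (U (j x)).1)) (c : (x y : X) → Γ(X, X.basicOpen (g x))),
      (∀ x, x ∈ X.basicOpen (g x)) ∧ (⨆ x, X.basicOpen (g x) = ⊤) ∧
      (∀ x y, X.basicOpen (g x) ⊓ X.basicOpen (g y) = X.basicOpen (c x y)) ∧ (∀ x, ∃ a, X.basicOpen (g x) ≤ W a) := by
  have hpt : ∀ x : X, ∃ (j : ι) (a : κ) (g : Γ(X, (U j).1)),
      X.basicOpen g ≤ W a ∧ x ∈ X.basicOpen g := fun x => by
    obtain ⟨j, hj⟩ := Opens.mem_iSup.mp (hU.ge (Set.mem_univ x) : x ∈ ⨆ j, (U j).1)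
    obtain ⟨a, ha⟩ := Opens.mem_iSup.mp (hW.ge (Set.mem_univ x) : x ∈ ⨆ a, W a)
    obtain ⟨g, hgW, hxg⟩ := (U j).2.exists_basicOpen_le ⟨x, ha⟩ hj
    exact ⟨j, a, g, hgW, hxg⟩
  choose j a g hgW hxg using hpt
  have hle : ∀ x y, X.basicOpen (b (j x) (j y)) ≤ (U (j y)).1 := fun x y => by
    rw [← hb]
    exact inf_le_right
  have hf : ∀ x y, ∃ f : Γ(X, (U (j x)).1),
      X.basicOpen f = X.basicOpen (X.presheaf.map (homOfLE (hle x y)).op (g y)) := fun x y =>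
    (U (j x)).2.basicOpen_basicOpen_is_basicOpen (b (j x) (j y)) _
  choose f hf using hf
  refine ⟨j, g, fun x y => X.presheaf.map (homOfLE (X.basicOpen_le (g x))).op (g x * f x y), hxg, ?_,
    fun x y => ?_, fun x => ⟨a x, hgW x⟩⟩
  · exact top_le_iff.mp fun x _ => Opens.mem_iSup.mpr ⟨x, hxg x⟩
  · have e1 : X.basicOpen (g x) ⊓ (U (j x)).1 = X.basicOpen (g x) := inf_eq_left.mpr (X.basicOpen_le _)
    have e2 : (U (j y)).1 ⊓ X.basicOpen (g y) = X.basicOpen (g y) := inf_eq_right.mpr (X.basicOpen_le _)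
    rw [Scheme.basicOpen_res, Scheme.basicOpen_mul, ← inf_assoc, inf_idem, hf, Scheme.basicOpen_res, ← hb]
    calc X.basicOpen (g x) ⊓ X.basicOpen (g y)
        = (X.basicOpen (g x) ⊓ (U (j x)).1) ⊓ ((U (j y)).1 ⊓ X.basicOpen (g y)) := by rw [e1, e2]
      _ = X.basicOpen (g x) ⊓ ((U (j x)).1 ⊓ (U (j y)).1 ⊓ X.basicOpen (g y)) := by ac_rfl

/-- **(BO) form, finite**: on a quasi-compact scheme, finitely many of the basic opens `D(g_x)` suffice (a finite index
type `τ` with `j : τ → ι`, `g s ∈ Γ(X, U_{j s})`, the `D(g s)` a principal affine cover subordinate to `W`).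
[cite: StacksProject, Tag 01K4] [cite: Hartshorne1977, II Ex. 2.16 (a)] -/
theorem exists_finite_principal_affine_cover_refinement_basicOpen [CompactSpace X] {ι : Type*}
    (U : ι → X.affineOpens) (b : (j l : ι) → Γ(X, (U j).1)) (hb : ∀ j l, (U j).1 ⊓ (U l).1 = X.basicOpen (b j l))
    (hU : ⨆ j, (U j).1 = ⊤) {κ : Type*} (W : κ → X.Opens) (hW : ⨆ a, W a = ⊤) :
    ∃ (τ : Type u) (_ : Finite τ) (j : τ → ι) (g : (s : τ) → Γ(X, (U (j s)).1))
      (c : (s t : τ) → Γ(X, X.basicOpen (g s))),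
      (⨆ s, X.basicOpen (g s) = ⊤) ∧ (∀ s t, X.basicOpen (g s) ⊓ X.basicOpen (g t) = X.basicOpen (c s t)) ∧
      (∀ s, ∃ a, X.basicOpen (g s) ≤ W a) := by
  obtain ⟨j, g, c, hxV, -, hc, hVW⟩ := exists_principal_affine_cover_refinement_basicOpen U b hb hU W hW
  obtain ⟨t, ht⟩ := isCompact_univ.elim_finite_subcover (fun x : X => (X.basicOpen (g x) : Set X))
    (fun x => (X.basicOpen (g x)).2) fun x _ => Set.mem_iUnion.mpr ⟨x, hxV x⟩
  refine ⟨↥t, inferInstance, fun s => j s.1, fun s => g s.1, fun s s' => c s.1 s'.1, ?_, fun s s' => hc s.1 s'.1,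
    fun s => hVW s.1⟩
  refine top_le_iff.mp fun x _ => ?_
  obtain ⟨y, hy, hxy⟩ := Set.mem_iUnion₂.mp (ht (Set.mem_univ x))
  exact Opens.mem_iSup.mpr ⟨⟨y, hy⟩, hxy⟩

end Literature.AlgebraicGeometry.Morphisms

end
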